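/-
Copyright (c) 2026 the pub-hodgecm-mathlib formalisation cell (harness21).  Prover seat hodgecm-mathlib-LH7-p07 (g0), Track A «(D-RAM) FOUR-FRAME» squad, helper lane on
h413 = stmt-HodgeConjecture-24833 (count-neutral).  β-BOARD v1 (sub-dealer LH4-p05 (g8)) LEDGER #6: row R7 «GLUE CLASSES», THEOREM C's three character sums.  2026-09-04.
-/
import Summits.HodgeConjecture.HodgeConjecture.Theorems.F0P3cDyRamFixedCountDiagonalModel       -- ★ `normSign_mul_norm` (`ω(x·(z·σz)) = ω(x)`)
import Literature.NumberTheory.LocalFields.WildQuadraticDatumNormSignConductor   -- ★ toolkit: `exists_fixed_unit_not_norm_v_sub_one_le`, `normSign_mul_eq_neg_of_not_norm`, `normSign_mul_eq_of_fixed_of_v_sub_one_le`, `normSign_mul_of_fixed`, `sum_normSign_repr_eq_zero`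
import HarnessLib

/-!
# Crux `H413`, line LH4 «(D-RAM) FOUR-FRAME» — β-BOARD R7 «GLUE CLASSES», THE THREE CHARACTER SUMS OF THEOREM C: (s1) the fixed SHELL `Σ_{v(y) = 2e} ω(y) = 0`,
# (s0) the MÖBIUS sum `Σ_{v(h) = E} ω(h(1−h)) = 0`, (s2) the CONDUCTOR-BALL sums `Σ_{b ∈ 𝔭_F^k} ω(1 + θb + θ₂b²) = 0` (`1 ≤ k ≤ d−1`) — over complete irredundant residue systems

Cell `hodgecm-mathlib` (D-0151), FLOOR 0, crux item H413 = `stmt-HodgeConjecture-24833`, route `HCCMUnconditional`; squad F0∕P3c∕LH4, β-BOARD v1 row R7 (holder LH7-p05 (g0),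
SIG `F0/P3c/LH7/LH7-p05/g0/SIG-R7-GlueClasses.v1.LH7p05g0.md` §3; sub-dealer LEDGER #6 «LH7-p07: the three character-sum lemmas as ONE pure-arithmetic file»; mechanism note
`F0/P3c/LH7/LH7-p07/g0/r7model/R7-GLUE-MECHANISM.v1.LH7p07g0.md`).  THEOREMS ONLY (no `def`, no instance, no notation, no `sorry`, default heartbeats); ★-only imports; lane
`--supports stmt-HodgeConjecture-24833 --as helper`; pays NO row, states NO law.  PURE LOCAL ARITHMETIC of a ramified quadratic datum `(σ, ϖ; d, t)` on ONE complete valued field `K`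
with finite residue field (`F` = the `σ`-fixed elements, `ω = normSign σ`, conductor exponent `d` by the ★ toolkit); nothing about lattices.

CURRENCY (the ★ toolkit's, ★ `sum_normSign_repr_eq_zero`): a set `A ⊆ K` and a Finset `S` which is a COMPLETE IRREDUNDANT SYSTEM OF REPRESENTATIVES of `A` modulo `𝔭^N`
(`hS1 : S ⊆ A`, `hS2 : ∀ a ∈ A, ∃ s ∈ S, |a − s| ≤ |ϖ|^N`, `hS3 : s, s′ ∈ S, |s − s′| ≤ |ϖ|^N ⇒ s = s′`).  ONE ENGINE (§1, datum-free): a self-map `φ` of `A` which is a CLASS ISOMETRY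
(`|φa − φa′| ≤ |ϖ|^N ↔ |a − a′| ≤ |ϖ|^N`) permutes the classes, so `Σ_{s ∈ S} F(φ s) = Σ_{s ∈ S} F(s)` for every class function `F` (`rep ∘ φ` is an injective self-map of the finite
`S`); if moreover `F ∘ φ = −F` on `A` the sum VANISHES.  The three sums are three instances: (s1) `φ = c·(−)` (`c` the ★ §2 non-norm in `U_F(2d−2)`, `ω(c·y) = −ω(y)`) on the shell
`{σy = y, |y| = |ϖ|^{2e}}`; (s0) the Möbius map `φ(h) = ch∕(1 + (c−1)h)` on `{σh = h, |h| = |ϖ|^E, |1−h| = 1}` (`φ(h)(1−φ(h)) = c·h(1−h)∕(1+(c−1)h)²`, the square is a norm); (s2)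
`φ(b) = cb + (c − 1)` on the ball `{σb = b, |b| ≤ |ϖ|^{2k}}` (`1 ≤ k ≤ d − 1`, so `c − 1 ∈ 𝔭^{2d−2} ⊆ 𝔭^{2k}`; `1 + φ(b) = c·(1+b)`) — and the quadratic letter `1 + θb + θ₂b²`
by the invariance half with the class-isometric self-maps `b ↦ θb` and `b ↦ θb + θ₂b²` of the ball (§4).
* §0 letter: `normSign_eq_of_rel_near` (`ω(x′) = ω(x)` when `|x − x′| ≤ |ϖ|^{2d−1}·|x|`, fixed non-zero `x`); the norm-factor letter `ω(x·(z·σz)) = ω(x)` is ★ `normSign_mul_norm`.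
* §1 `sum_comp_eq_sum_of_classIsometry`, `sum_eq_zero_of_classIsometry_flip` (datum-free).
* §2 (s1) `sum_normSign_repr_shell_eq_zero`; affine form `sum_normSign_add_repr_eq_zero` (`Σ_{r} ω(r + c₀) = 0` over reps of `{σr = r, |r + c₀| = |ϖ|^{2e}}`).
* §3 (s0) `sum_normSign_mul_one_sub_repr_eq_zero` (`2 ≤ d`; all `E`, with the clause `|1 − h| = 1`), `…_of_pos` (`0 < E`: the clause is automatic).
* §4 (s2) `sum_normSign_one_add_repr_ball_eq_zero` (`Σ_{b} ω(1 + b) = 0`), `sum_normSign_one_add_mul_repr_ball_eq_zero` (`Σ_{b} ω(1 + θb) = 0`, `θ` a fixed unit),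
  `sum_normSign_quad_repr_ball_eq_zero` (`Σ_{b} ω(1 + θb + θ₂b²) = 0`, `θ` a fixed unit, `θ₂` fixed integral).
HONEST LABEL.  Count-neutral arithmetic; R7 Theorem C, the (β) table, (β-BAL), T₊ stay OPEN; `HC_CM` is proved only modulo the 7 printed citations (2 remaining named inputs: hLiu418 =
`stmt-HodgeConjecture-24832`, h413 = `stmt-HodgeConjecture-24833`) until rung 0 closes.

## References
* [Serre1979] J.-P. Serre, *Local Fields*, GTM 67 (1979): Ch. V §3 Prop. 5, Cor. 2–3 pp. 85–87 (norm groups of a ramified quadratic extension; the conductor), Ch. XV §2.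
* [NeukirchANT1999] J. Neukirch, *Algebraic Number Theory* (1999): Ch. V (1.3) (local norm index).
* [IrelandRosen1990] K. Ireland, M. Rosen, *A Classical Introduction to Modern Number Theory*, GTM 84 (1990): Ch. 8 §3 (Jacobi-type sums `Σ χ(h)χ(1−h)`; here killed by a Möbius involution).
-/

set_option autoImplicit false

noncomputable section

namespace Summit.HodgeConjecture.HodgeConjecture.Cruxes.H413.F0P3cDyRamGlueClassCharSums

open WithZero
open scoped Valued
open Literature.NumberTheory.Automorphic.UnitaryThreeFourFrame
open Literature.NumberTheory.LocalFields.WildQuadraticDatum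
open Summit.HodgeConjecture.HodgeConjecture.Cruxes.H413.F0P3cDyRamFixedCountDiagonalModel (normSign_mul_norm)

variable {K : Type} [Field K] [Valued K ℤᵐ⁰] {σ : K →+* K} {ϖ : K} {d t : ℕ}

/-! ## §0  One letter on `ω` -/

/-- **`ω(x′) = ω(x)` WHEN `x′` IS RELATIVELY `𝔭^{2d−1}`-CLOSE TO A FIXED NON-ZERO `x`**: `σx = x`, `σx′ = x′`, `x ≠ 0`, `|x − x′| ≤ |ϖ|^n·|x|`, `n ≥ 2d − 1` (then `x′ = x·u` with
`u ∈ U_F(n)`, a norm: ★ `normSign_mul_eq_of_fixed_of_v_sub_one_le`). [cite: Serre1979, Ch. XV §2] -/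
theorem normSign_eq_of_rel_near [CompleteSpace K] (hD : IsRamifiedQuadraticDatum σ ϖ d t) {x x' : K} (hσx : σ x = x) (hσx' : σ x' = x') (hx0 : x ≠ 0)
    {n : ℕ} (hn : 2 * d - 1 ≤ n) (h : Valued.v (x - x') ≤ Valued.v ϖ ^ n * Valued.v x) : normSign σ x' = normSign σ x := by
  have e : x' = x * (x' / x) := by field_simp
  have hσq : σ (x' / x) = x' / x := by rw [map_div₀, hσx, hσx']
  have hxpos : 0 < Valued.v x := (Valuation.pos_iff _).2 hx0
  have hq : Valued.v (x' / x - 1) ≤ Valued.v ϖ ^ n := by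
    have e2 : x' / x - 1 = -((x - x') / x) := by field_simp; ring
    rw [e2, Valuation.map_neg, map_div₀, div_eq_mul_inv, mul_inv_le_iff₀ hxpos]
    exact h
  rw [e, normSign_mul_eq_of_fixed_of_v_sub_one_le hD x hσq hn hq]

/-! ## §1  The engine: class isometries of a complete irredundant residue system (datum-free) -/

/-- **A CLASS-ISOMETRIC SELF-MAP PERMUTES THE CLASSES**: `S` a complete irredundant system of representatives of `A` modulo `𝔭^N`, `φ(A) ⊆ A` with
`|φa − φa′| ≤ |ϖ|^N ↔ |a − a′| ≤ |ϖ|^N` on `A`, and `F` constant on the `𝔭^N`-classes of `A`: then `Σ_{s ∈ S} F(φ s) = Σ_{s ∈ S} F(s)` (the map `s ↦ rep(φ s)` is an injective,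
hence bijective, self-map of `S`). [cite: Serre1979, Ch. XV §2] -/
theorem sum_comp_eq_sum_of_classIsometry {A : Set K} {N : ℕ} (S : Finset K) (hS1 : ∀ s ∈ S, s ∈ A)
    (hS2 : ∀ a ∈ A, ∃ s ∈ S, Valued.v (a - s) ≤ Valued.v ϖ ^ N) (hS3 : ∀ s ∈ S, ∀ s' ∈ S, Valued.v (s - s') ≤ Valued.v ϖ ^ N → s = s')
    (φ : K → K) (hφA : ∀ a ∈ A, φ a ∈ A) (hφ : ∀ a ∈ A, ∀ a' ∈ A, Valued.v (φ a - φ a') ≤ Valued.v ϖ ^ N ↔ Valued.v (a - a') ≤ Valued.v ϖ ^ N)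
    (F : K → ℤ) (hF : ∀ a ∈ A, ∀ a' ∈ A, Valued.v (a - a') ≤ Valued.v ϖ ^ N → F a = F a') :
    ∑ s ∈ S, F (φ s) = ∑ s ∈ S, F s := by
  classical
  -- the representative `ψ s ∈ S` of `φ s`
  have hrep : ∀ s ∈ S, ∃ s' ∈ S, Valued.v (φ s - s') ≤ Valued.v ϖ ^ N := fun s hs => hS2 (φ s) (hφA s (hS1 s hs))
  choose! ψ hψS hψ using hrep
  have hFψ : ∀ s ∈ S, F (φ s) = F (ψ s) := fun s hs =>
    hF (φ s) (hφA s (hS1 s hs)) (ψ s) (hS1 _ (hψS s hs)) (hψ s hs)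
  -- `ψ` is injective on `S`, hence a bijection of `S`
  have hinj : ∀ s₁ ∈ S, ∀ s₂ ∈ S, ψ s₁ = ψ s₂ → s₁ = s₂ := by
    intro s₁ hs₁ s₂ hs₂ heq
    apply hS3 s₁ hs₁ s₂ hs₂
    apply (hφ s₁ (hS1 s₁ hs₁) s₂ (hS1 s₂ hs₂)).1
    have h1 := hψ s₁ hs₁
    have h2 := hψ s₂ hs₂
    rw [heq] at h1
    have e : φ s₁ - φ s₂ = (φ s₁ - ψ s₂) - (φ s₂ - ψ s₂) := by ring
    rw [e]
    exact (Valuation.map_sub _ _ _).trans (max_le h1 h2)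
  have hsum : ∑ s ∈ S, F (ψ s) = ∑ s ∈ S, F s :=
    Finset.sum_bij (fun s _ => ψ s) (fun s hs => hψS s hs) (fun s₁ hs₁ s₂ hs₂ h => hinj s₁ hs₁ s₂ hs₂ h)
      (fun s' hs' => by
        -- surjectivity from injectivity on a finite set
        have himg : (S.image ψ) = S := Finset.eq_of_subset_of_card_le (Finset.image_subset_iff.2 fun s hs => hψS s hs)
          (by rw [Finset.card_image_of_injOn (fun s₁ hs₁ s₂ hs₂ h => hinj s₁ hs₁ s₂ hs₂ h)])
        have hs'' : s' ∈ S.image ψ := by rw [himg]; exact hs'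
        obtain ⟨s, hs, hss'⟩ := Finset.mem_image.1 hs''
        exact ⟨s, hs, hss'⟩)
      (fun _ _ => rfl)
  rw [← hsum]
  exact Finset.sum_congr rfl hFψ

/-- **A SIGN-FLIPPING CLASS ISOMETRY KILLS THE SUM**: under the hypotheses of `sum_comp_eq_sum_of_classIsometry`, if `F(φ a) = −F(a)` on `A` then `Σ_{s ∈ S} F(s) = 0`.
[cite: Serre1979, Ch. XV §2] -/
theorem sum_eq_zero_of_classIsometry_flip {A : Set K} {N : ℕ} (S : Finset K) (hS1 : ∀ s ∈ S, s ∈ A)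
    (hS2 : ∀ a ∈ A, ∃ s ∈ S, Valued.v (a - s) ≤ Valued.v ϖ ^ N) (hS3 : ∀ s ∈ S, ∀ s' ∈ S, Valued.v (s - s') ≤ Valued.v ϖ ^ N → s = s')
    (φ : K → K) (hφA : ∀ a ∈ A, φ a ∈ A) (hφ : ∀ a ∈ A, ∀ a' ∈ A, Valued.v (φ a - φ a') ≤ Valued.v ϖ ^ N ↔ Valued.v (a - a') ≤ Valued.v ϖ ^ N)
    (F : K → ℤ) (hF : ∀ a ∈ A, ∀ a' ∈ A, Valued.v (a - a') ≤ Valued.v ϖ ^ N → F a = F a') (hflip : ∀ a ∈ A, F (φ a) = -F a) :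
    ∑ s ∈ S, F s = 0 := by
  have h := sum_comp_eq_sum_of_classIsometry S hS1 hS2 hS3 φ hφA hφ F hF
  have hneg : ∑ s ∈ S, F (φ s) = -∑ s ∈ S, F s := by
    rw [← Finset.sum_neg_distrib]
    exact Finset.sum_congr rfl fun s hs => hflip s (hS1 s hs)
  have h2 : (2 : ℤ) * ∑ s ∈ S, F s = 0 := by linarith
  simpa using h2

/-! ## §2  (s1) The fixed shell `|y| = |ϖ|^{2e}`: `Σ ω(y) = 0` -/

/-- **(s1) `Σ_{y ∈ S} ω(y) = 0` OVER A COMPLETE IRREDUNDANT SYSTEM OF THE FIXED SHELL `{σy = y, |y| = |ϖ|^{2e}}` MODULO `𝔭^N`, `N ≥ 2e + 2d − 1`** (the non-norm `c ∈ U_F(2d−2)`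
multiplies the shell into itself and flips `ω`; §1). [cite: Serre1979, Ch. V §3 Cor. 3; Ch. XV §2] [cite: NeukirchANT1999, Ch. V (1.3)] -/
theorem sum_normSign_repr_shell_eq_zero [CompleteSpace K] [Finite 𝓀[K]] (hD : IsRamifiedQuadraticDatum σ ϖ d t) (h2v : Valued.v (2 : K) < 1)
    (e : ℕ) {N : ℕ} (hN : 2 * e + (2 * d - 1) ≤ N) (S : Finset K) (hS1 : ∀ y ∈ S, σ y = y ∧ Valued.v y = Valued.v ϖ ^ (2 * e))
    (hS2 : ∀ y : K, σ y = y → Valued.v y = Valued.v ϖ ^ (2 * e) → ∃ s ∈ S, Valued.v (y - s) ≤ Valued.v ϖ ^ N)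
    (hS3 : ∀ s ∈ S, ∀ s' ∈ S, Valued.v (s - s') ≤ Valued.v ϖ ^ N → s = s') :
    ∑ y ∈ S, normSign σ y = 0 := by
  obtain ⟨-, -, hϖ, -, -, -, -⟩ := id hD
  have hϖ1 : Valued.v ϖ ≤ 1 := by rw [hϖ, ← exp_zero]; exact exp_le_exp.2 (by norm_num)
  have hvϖ0 : Valued.v ϖ ≠ 0 := by rw [hϖ]; exact exp_ne_zero
  obtain ⟨c, hσc, hc1, -, hcn⟩ := exists_fixed_unit_not_norm_v_sub_one_le hD h2v
  have hNle : Valued.v ϖ ^ N ≤ Valued.v ϖ ^ (2 * d - 1) * Valued.v ϖ ^ (2 * e) := by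
    rw [← pow_add]; exact pow_le_pow_right_of_le_one' hϖ1 (by omega)
  refine sum_eq_zero_of_classIsometry_flip (A := {y : K | σ y = y ∧ Valued.v y = Valued.v ϖ ^ (2 * e)}) S hS1
    (fun y hy => hS2 y hy.1 hy.2) hS3 (fun y => c * y) ?_ ?_ (fun y => normSign σ y) ?_ ?_
  · rintro y ⟨hσy, hvy⟩
    exact ⟨by rw [map_mul, hσc, hσy], by rw [map_mul, hc1, one_mul, hvy]⟩
  · rintro y - y' -
    rw [← mul_sub, map_mul, hc1, one_mul]
  · rintro y ⟨hσy, hvy⟩ y' ⟨hσy', -⟩ hyy'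
    have hy0 : y ≠ 0 := fun h0 => by rw [h0, map_zero] at hvy; exact pow_ne_zero _ hvϖ0 hvy.symm
    exact (normSign_eq_of_rel_near hD hσy hσy' hy0 le_rfl (hyy'.trans (by rw [hvy]; exact hNle))).symm
  · rintro y ⟨hσy, hvy⟩
    have hy0 : y ≠ 0 := fun h0 => by rw [h0, map_zero] at hvy; exact pow_ne_zero _ hvϖ0 hvy.symm
    exact normSign_mul_eq_neg_of_not_norm hD hσc hcn hσy hy0

/-- **(s1, affine form) `Σ_{r ∈ S} ω(r + c₀) = 0`** over a complete irredundant system modulo `𝔭^N` of `{σr = r, |r + c₀| = |ϖ|^{2e}}` (`c₀` fixed; `r ↦ c(r + c₀) − c₀` is a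
class isometry of that set which flips `ω(· + c₀)`), `N ≥ 2e + 2d − 1`. [cite: Serre1979, Ch. V §3 Cor. 3; Ch. XV §2] -/
theorem sum_normSign_add_repr_eq_zero [CompleteSpace K] [Finite 𝓀[K]] (hD : IsRamifiedQuadraticDatum σ ϖ d t) (h2v : Valued.v (2 : K) < 1)
    {c₀ : K} (hσc₀ : σ c₀ = c₀) (e : ℕ) {N : ℕ} (hN : 2 * e + (2 * d - 1) ≤ N) (S : Finset K)
    (hS1 : ∀ r ∈ S, σ r = r ∧ Valued.v (r + c₀) = Valued.v ϖ ^ (2 * e))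
    (hS2 : ∀ r : K, σ r = r → Valued.v (r + c₀) = Valued.v ϖ ^ (2 * e) → ∃ s ∈ S, Valued.v (r - s) ≤ Valued.v ϖ ^ N)
    (hS3 : ∀ s ∈ S, ∀ s' ∈ S, Valued.v (s - s') ≤ Valued.v ϖ ^ N → s = s') :
    ∑ r ∈ S, normSign σ (r + c₀) = 0 := by
  obtain ⟨-, -, hϖ, -, -, -, -⟩ := id hD
  have hϖ1 : Valued.v ϖ ≤ 1 := by rw [hϖ, ← exp_zero]; exact exp_le_exp.2 (by norm_num)
  have hvϖ0 : Valued.v ϖ ≠ 0 := by rw [hϖ]; exact exp_ne_zero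
  obtain ⟨c, hσc, hc1, -, hcn⟩ := exists_fixed_unit_not_norm_v_sub_one_le hD h2v
  have hNle : Valued.v ϖ ^ N ≤ Valued.v ϖ ^ (2 * d - 1) * Valued.v ϖ ^ (2 * e) := by
    rw [← pow_add]; exact pow_le_pow_right_of_le_one' hϖ1 (by omega)
  refine sum_eq_zero_of_classIsometry_flip (A := {r : K | σ r = r ∧ Valued.v (r + c₀) = Valued.v ϖ ^ (2 * e)}) S hS1
    (fun r hr => hS2 r hr.1 hr.2) hS3 (fun r => c * (r + c₀) - c₀) ?_ ?_ (fun r => normSign σ (r + c₀)) ?_ ?_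
  · rintro r ⟨hσr, hvr⟩
    refine ⟨by rw [map_sub, map_mul, map_add, hσc, hσr, hσc₀], ?_⟩
    rw [sub_add_cancel, map_mul, hc1, one_mul, hvr]
  · rintro r - r' -
    rw [show c * (r + c₀) - c₀ - (c * (r' + c₀) - c₀) = c * (r - r') by ring, map_mul, hc1, one_mul]
  · rintro r ⟨hσr, hvr⟩ r' ⟨hσr', -⟩ hrr'
    have hy0 : r + c₀ ≠ 0 := fun h0 => by rw [h0, map_zero] at hvr; exact pow_ne_zero _ hvϖ0 hvr.symm
    refine (normSign_eq_of_rel_near hD (by rw [map_add, hσr, hσc₀]) (by rw [map_add, hσr', hσc₀]) hy0 le_rfl ?_).symm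
    rw [show r + c₀ - (r' + c₀) = r - r' by ring, hvr]
    exact hrr'.trans hNle
  · rintro r ⟨hσr, hvr⟩
    have hy0 : r + c₀ ≠ 0 := fun h0 => by rw [h0, map_zero] at hvr; exact pow_ne_zero _ hvϖ0 hvr.symm
    show normSign σ (c * (r + c₀) - c₀ + c₀) = -normSign σ (r + c₀)
    rw [sub_add_cancel]
    exact normSign_mul_eq_neg_of_not_norm hD hσc hcn (by rw [map_add, hσr, hσc₀]) hy0

/-! ## §3  (s0) The Möbius sum `Σ ω(h(1−h)) = 0` on the shell `|h| = |ϖ|^E`, `|1 − h| = 1` -/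

/-- **(s0) `Σ_{h ∈ S} ω(h·(1 − h)) = 0` OVER A COMPLETE IRREDUNDANT SYSTEM MODULO `𝔭^N` OF `{σh = h, |h| = |ϖ|^E, |1 − h| = 1}`**, `2 ≤ d`, `N ≥ E + 2d − 1`: the Möbius map
`h ↦ ch∕(1 + (c−1)h)` (`c` the ★ non-norm in `U_F(2d−2)`) is a class isometry of that set with `φ(h)(1−φ(h)) = c·h(1−h)·(1+(c−1)h)⁻²`, so it flips `ω` (the square of a fixed element is a
norm); §1.  At `E = 0` this is the Jacobi-type sum of the on-foot `κ`-class, at `E ≥ 2` the clause `|1 − h| = 1` is automatic (`…_of_pos`).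
[cite: IrelandRosen1990, Ch. 8 §3] [cite: Serre1979, Ch. V §3 Cor. 3; Ch. XV §2] -/
theorem sum_normSign_mul_one_sub_repr_eq_zero [CompleteSpace K] [Finite 𝓀[K]] (hD : IsRamifiedQuadraticDatum σ ϖ d t) (h2v : Valued.v (2 : K) < 1) (h2d : 2 ≤ d)
    (E : ℕ) {N : ℕ} (hN : E + (2 * d - 1) ≤ N) (S : Finset K) (hS1 : ∀ h ∈ S, σ h = h ∧ Valued.v h = Valued.v ϖ ^ E ∧ Valued.v (1 - h) = 1)
    (hS2 : ∀ h : K, σ h = h → Valued.v h = Valued.v ϖ ^ E → Valued.v (1 - h) = 1 → ∃ s ∈ S, Valued.v (h - s) ≤ Valued.v ϖ ^ N)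
    (hS3 : ∀ s ∈ S, ∀ s' ∈ S, Valued.v (s - s') ≤ Valued.v ϖ ^ N → s = s') :
    ∑ h ∈ S, normSign σ (h * (1 - h)) = 0 := by
  obtain ⟨hσ, -, hϖ, -, -, -, -⟩ := id hD
  have hϖ1 : Valued.v ϖ ≤ 1 := by rw [hϖ, ← exp_zero]; exact exp_le_exp.2 (by norm_num)
  have hvϖ0 : Valued.v ϖ ≠ 0 := by rw [hϖ]; exact exp_ne_zero
  obtain ⟨c, hσc, hc1, hcd, hcn⟩ := exists_fixed_unit_not_norm_v_sub_one_le hD h2v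
  -- `|c − 1| < 1` (`d ≥ 2`)
  have hc1lt : Valued.v (c - 1) < 1 := by
    refine lt_of_le_of_lt hcd ?_
    rw [← exp_zero, exp_lt_exp]; omega
  have hNle : Valued.v ϖ ^ N ≤ Valued.v ϖ ^ (2 * d - 1) * Valued.v ϖ ^ E := by
    rw [← pow_add]; exact pow_le_pow_right_of_le_one' hϖ1 (by omega)
  -- the denominator `w(h) = 1 + (c−1)h` is a fixed unit when `|h| ≤ 1`
  have hw : ∀ h : K, σ h = h → Valued.v h ≤ 1 → σ (1 + (c - 1) * h) = 1 + (c - 1) * h ∧ Valued.v (1 + (c - 1) * h) = 1 := fun h hσh hvh =>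
    ⟨by rw [map_add, map_one, map_mul, map_sub, hσc, map_one, hσh],
      Valued.v.map_one_add_of_lt (by rw [map_mul]; exact mul_lt_one_of_nonneg_of_lt_one_left zero_le hc1lt hvh)⟩
  have hvE : ∀ h : K, Valued.v h = Valued.v ϖ ^ E → Valued.v h ≤ 1 := fun h hvh => by rw [hvh]; exact pow_le_one₀ zero_le hϖ1
  set φ : K → K := fun h => c * h / (1 + (c - 1) * h) with hφdef
  refine sum_eq_zero_of_classIsometry_flip (A := {h : K | σ h = h ∧ Valued.v h = Valued.v ϖ ^ E ∧ Valued.v (1 - h) = 1}) S hS1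
    (fun h hh => hS2 h hh.1 hh.2.1 hh.2.2) hS3 φ ?_ ?_ (fun h => normSign σ (h * (1 - h))) ?_ ?_
  · -- `φ` preserves the set
    rintro h ⟨hσh, hvh, h1h⟩
    obtain ⟨hσw, hvw⟩ := hw h hσh (hvE h hvh)
    have hw0 : 1 + (c - 1) * h ≠ 0 := fun h0 => by rw [h0, map_zero] at hvw; exact zero_ne_one hvw
    refine ⟨by rw [hφdef]; dsimp only; rw [map_div₀, map_mul, hσc, hσh, hσw], ?_, ?_⟩
    · rw [hφdef]; dsimp only; rw [map_div₀, map_mul, hc1, one_mul, hvw, div_one, hvh]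
    · rw [hφdef]; dsimp only
      set w : K := 1 + (c - 1) * h with hwdef
      have e1 : 1 - c * h / w = (1 - h) / w := by
        rw [eq_div_iff hw0, sub_mul, div_mul_cancel₀ _ hw0, hwdef]; ring
      rw [e1, map_div₀, h1h, hvw, div_one]
  · -- class isometry: `φh − φh′ = c(h − h′)∕(w(h)w(h′))`
    rintro h ⟨hσh, hvh, -⟩ h' ⟨hσh', hvh', -⟩
    obtain ⟨-, hvw⟩ := hw h hσh (hvE h hvh)
    obtain ⟨-, hvw'⟩ := hw h' hσh' (hvE h' hvh')
    have hw0 : 1 + (c - 1) * h ≠ 0 := fun h0 => by rw [h0, map_zero] at hvw; exact zero_ne_one hvw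
    have hw0' : 1 + (c - 1) * h' ≠ 0 := fun h0 => by rw [h0, map_zero] at hvw'; exact zero_ne_one hvw'
    rw [hφdef]; dsimp only
    set w : K := 1 + (c - 1) * h with hwdef
    set w' : K := 1 + (c - 1) * h' with hw'def
    have e1 : c * h / w - c * h' / w' = c * (h - h') / (w * w') := by
      rw [div_sub_div _ _ hw0 hw0']
      congr 1
      rw [hwdef, hw'def]; ring
    rw [e1, map_div₀, map_mul, map_mul, hc1, hvw, hvw', one_mul, mul_one, div_one]
  · -- `ω(h(1−h))` is constant on the classes
    rintro h ⟨hσh, hvh, h1h⟩ h' ⟨hσh', hvh', -⟩ hhh'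
    have hx0 : h * (1 - h) ≠ 0 := by
      refine mul_ne_zero (fun h0 => ?_) (fun h0 => ?_)
      · rw [h0, map_zero] at hvh; exact pow_ne_zero _ hvϖ0 hvh.symm
      · rw [h0, map_zero] at h1h; exact zero_ne_one h1h
    refine (normSign_eq_of_rel_near hD (by rw [map_mul, map_sub, map_one, hσh]) (by rw [map_mul, map_sub, map_one, hσh']) hx0 le_rfl ?_).symm
    have e1 : h * (1 - h) - h' * (1 - h') = (h - h') * (1 - h - h') := by ring
    have hle : Valued.v (1 - h - h') ≤ 1 := by
      refine (Valuation.map_sub _ _ _).trans (max_le ?_ (hvE h' hvh'))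
      rw [h1h]
    rw [e1, map_mul, map_mul, hvh, h1h, mul_one]
    calc Valued.v (h - h') * Valued.v (1 - h - h') ≤ Valued.v ϖ ^ N * 1 := mul_le_mul' hhh' hle
      _ ≤ Valued.v ϖ ^ (2 * d - 1) * Valued.v ϖ ^ E := by rw [mul_one]; exact hNle
  · -- the flip: `φh·(1−φh) = (h(1−h))·c·(w⁻¹·σw⁻¹)`
    rintro h ⟨hσh, hvh, h1h⟩
    obtain ⟨hσw, hvw⟩ := hw h hσh (hvE h hvh)
    have hw0 : 1 + (c - 1) * h ≠ 0 := fun h0 => by rw [h0, map_zero] at hvw; exact zero_ne_one hvw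
    have hx0 : h * (1 - h) ≠ 0 := by
      refine mul_ne_zero (fun h0 => ?_) (fun h0 => ?_)
      · rw [h0, map_zero] at hvh; exact pow_ne_zero _ hvϖ0 hvh.symm
      · rw [h0, map_zero] at h1h; exact zero_ne_one h1h
    show normSign σ (c * h / (1 + (c - 1) * h) * (1 - c * h / (1 + (c - 1) * h))) = -normSign σ (h * (1 - h))
    set w : K := 1 + (c - 1) * h with hwdef
    have e1 : 1 - c * h / w = (1 - h) / w := by
      rw [eq_div_iff hw0, sub_mul, div_mul_cancel₀ _ hw0, hwdef]; ring
    have e2 : c * h / w * ((1 - h) / w) = c * (h * (1 - h)) * (w⁻¹ * w⁻¹) := by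
      rw [div_eq_mul_inv, div_eq_mul_inv]; ring
    have e3 : (w⁻¹ * w⁻¹ : K) = w⁻¹ * σ (w⁻¹) := by rw [map_inv₀, hσw]
    rw [e1, e2, e3, normSign_mul_norm σ _ (inv_ne_zero hw0),
      normSign_mul_eq_neg_of_not_norm hD hσc hcn (by rw [map_mul, map_sub, map_one, hσh]) hx0]

/-- **(s0) FOR `0 < E`** (then `|1 − h| = 1` is automatic and the system is one of `{σh = h, |h| = |ϖ|^E}`). [cite: IrelandRosen1990, Ch. 8 §3] [cite: Serre1979, Ch. XV §2] -/
theorem sum_normSign_mul_one_sub_repr_eq_zero_of_pos [CompleteSpace K] [Finite 𝓀[K]] (hD : IsRamifiedQuadraticDatum σ ϖ d t) (h2v : Valued.v (2 : K) < 1)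
    (h2d : 2 ≤ d) {E : ℕ} (hE : 0 < E) {N : ℕ} (hN : E + (2 * d - 1) ≤ N) (S : Finset K) (hS1 : ∀ h ∈ S, σ h = h ∧ Valued.v h = Valued.v ϖ ^ E)
    (hS2 : ∀ h : K, σ h = h → Valued.v h = Valued.v ϖ ^ E → ∃ s ∈ S, Valued.v (h - s) ≤ Valued.v ϖ ^ N)
    (hS3 : ∀ s ∈ S, ∀ s' ∈ S, Valued.v (s - s') ≤ Valued.v ϖ ^ N → s = s') :
    ∑ h ∈ S, normSign σ (h * (1 - h)) = 0 := by
  obtain ⟨-, -, hϖ, -, -, -, -⟩ := id hD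
  have hϖ1 : Valued.v ϖ < 1 := by rw [hϖ, ← exp_zero]; exact exp_lt_exp.2 (by norm_num)
  have h1h : ∀ h : K, Valued.v h = Valued.v ϖ ^ E → Valued.v (1 - h) = 1 := fun h hvh =>
    Valued.v.map_one_sub_of_lt (by rw [hvh]; exact pow_lt_one₀ zero_le hϖ1 (by omega))
  exact sum_normSign_mul_one_sub_repr_eq_zero hD h2v h2d E hN S (fun h hh => ⟨(hS1 h hh).1, (hS1 h hh).2, h1h h (hS1 h hh).2⟩)
    (fun h hσh hvh _ => hS2 h hσh hvh) hS3

/-! ## §4  (s2) The conductor-ball sums: `Σ_{b ∈ 𝔭_F^k} ω(1 + b) = 0` and its reparametrisations, `1 ≤ k ≤ d − 1` -/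

/-- **(s2) `Σ_{b ∈ S} ω(1 + b) = 0` OVER A COMPLETE IRREDUNDANT SYSTEM MODULO `𝔭^N` OF THE FIXED BALL `{σb = b, |b| ≤ |ϖ|^{2k}}`**, `1 ≤ k`, `k + 1 ≤ d`, `N ≥ 2d − 1`: the affine
map `b ↦ cb + (c − 1)` (`c` the ★ non-norm in `U_F(2d−2)`, `c − 1 ∈ 𝔭^{2k}`) is a class isometry of the ball with `1 + φ(b) = c·(1 + b)`; §1.  (`ω` is NOT trivial on `U_F(2k)` for
`2k ≤ 2d − 2`.) [cite: Serre1979, Ch. V §3 Cor. 3; Ch. XV §2] [cite: NeukirchANT1999, Ch. V (1.3)] -/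
theorem sum_normSign_one_add_repr_ball_eq_zero [CompleteSpace K] [Finite 𝓀[K]] (hD : IsRamifiedQuadraticDatum σ ϖ d t) (h2v : Valued.v (2 : K) < 1)
    {k : ℕ} (hk : 1 ≤ k) (hkd : k + 1 ≤ d) {N : ℕ} (hN : 2 * d - 1 ≤ N) (S : Finset K) (hS1 : ∀ b ∈ S, σ b = b ∧ Valued.v b ≤ Valued.v ϖ ^ (2 * k))
    (hS2 : ∀ b : K, σ b = b → Valued.v b ≤ Valued.v ϖ ^ (2 * k) → ∃ s ∈ S, Valued.v (b - s) ≤ Valued.v ϖ ^ N)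
    (hS3 : ∀ s ∈ S, ∀ s' ∈ S, Valued.v (s - s') ≤ Valued.v ϖ ^ N → s = s') :
    ∑ b ∈ S, normSign σ (1 + b) = 0 := by
  obtain ⟨-, -, hϖ, -, -, -, -⟩ := id hD
  have hϖ1 : Valued.v ϖ < 1 := by rw [hϖ, ← exp_zero]; exact exp_lt_exp.2 (by norm_num)
  obtain ⟨c, hσc, hc1, hcd, hcn⟩ := exists_fixed_unit_not_norm_v_sub_one_le hD h2v
  -- `|c − 1| ≤ |ϖ|^{2k}`
  have hcd' : Valued.v (c - 1) ≤ Valued.v ϖ ^ (2 * k) := by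
    refine hcd.trans ?_
    rw [v_varpi_pow hϖ, exp_le_exp]; push_cast; omega
  have hball1 : ∀ b : K, Valued.v b ≤ Valued.v ϖ ^ (2 * k) → Valued.v b < 1 := fun b hb =>
    lt_of_le_of_lt hb (pow_lt_one₀ zero_le hϖ1 (by omega))
  refine sum_eq_zero_of_classIsometry_flip (A := {b : K | σ b = b ∧ Valued.v b ≤ Valued.v ϖ ^ (2 * k)}) S hS1
    (fun b hb => hS2 b hb.1 hb.2) hS3 (fun b => c * b + (c - 1)) ?_ ?_ (fun b => normSign σ (1 + b)) ?_ ?_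
  · rintro b ⟨hσb, hvb⟩
    refine ⟨by rw [map_add, map_mul, map_sub, map_one, hσc, hσb], (Valuation.map_add _ _ _).trans (max_le ?_ hcd')⟩
    rw [map_mul, hc1, one_mul]; exact hvb
  · rintro b - b' -
    rw [show c * b + (c - 1) - (c * b' + (c - 1)) = c * (b - b') by ring, map_mul, hc1, one_mul]
  · rintro b ⟨hσb, -⟩ b' ⟨hσb', hvb'⟩ hbb'
    refine normSign_eq_of_near hD (by rw [map_add, map_one, hσb']) (by rw [map_add, map_one, hσb]) (Valued.v.map_one_add_of_lt (hball1 b' hvb')) hN ?_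
    rw [show 1 + b' - (1 + b) = b' - b by ring, Valuation.map_sub_swap]; exact hbb'
  · rintro b ⟨hσb, hvb⟩
    have h1b : Valued.v (1 + b) = 1 := Valued.v.map_one_add_of_lt (hball1 b hvb)
    have h1b0 : 1 + b ≠ 0 := fun h0 => by rw [h0, map_zero] at h1b; exact zero_ne_one h1b
    show normSign σ (1 + (c * b + (c - 1))) = -normSign σ (1 + b)
    rw [show 1 + (c * b + (c - 1)) = c * (1 + b) by ring]
    exact normSign_mul_eq_neg_of_not_norm hD hσc hcn (by rw [map_add, map_one, hσb]) h1b0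

/-- **(s2, linear letter) `Σ_{b ∈ S} ω(1 + θ·b) = 0`** for a fixed unit `θ` (the reparametrisation `b ↦ θb` is a class isometry of the ball; §1 invariance + the previous head).
[cite: Serre1979, Ch. XV §2] -/
theorem sum_normSign_one_add_mul_repr_ball_eq_zero [CompleteSpace K] [Finite 𝓀[K]] (hD : IsRamifiedQuadraticDatum σ ϖ d t) (h2v : Valued.v (2 : K) < 1)
    {θ : K} (hσθ : σ θ = θ) (hθ : Valued.v θ = 1) {k : ℕ} (hk : 1 ≤ k) (hkd : k + 1 ≤ d) {N : ℕ} (hN : 2 * d - 1 ≤ N) (S : Finset K)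
    (hS1 : ∀ b ∈ S, σ b = b ∧ Valued.v b ≤ Valued.v ϖ ^ (2 * k))
    (hS2 : ∀ b : K, σ b = b → Valued.v b ≤ Valued.v ϖ ^ (2 * k) → ∃ s ∈ S, Valued.v (b - s) ≤ Valued.v ϖ ^ N)
    (hS3 : ∀ s ∈ S, ∀ s' ∈ S, Valued.v (s - s') ≤ Valued.v ϖ ^ N → s = s') :
    ∑ b ∈ S, normSign σ (1 + θ * b) = 0 := by
  obtain ⟨-, -, hϖ, -, -, -, -⟩ := id hD
  have hϖ1 : Valued.v ϖ < 1 := by rw [hϖ, ← exp_zero]; exact exp_lt_exp.2 (by norm_num)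
  have hball1 : ∀ b : K, Valued.v b ≤ Valued.v ϖ ^ (2 * k) → Valued.v b < 1 := fun b hb =>
    lt_of_le_of_lt hb (pow_lt_one₀ zero_le hϖ1 (by omega))
  have h := sum_comp_eq_sum_of_classIsometry (A := {b : K | σ b = b ∧ Valued.v b ≤ Valued.v ϖ ^ (2 * k)}) S hS1
    (fun b hb => hS2 b hb.1 hb.2) hS3 (fun b => θ * b) ?_ ?_ (fun b => normSign σ (1 + b)) ?_
  · have h' : ∑ b ∈ S, normSign σ (1 + θ * b) = ∑ b ∈ S, normSign σ (1 + b) := h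
    rw [h']
    exact sum_normSign_one_add_repr_ball_eq_zero hD h2v hk hkd hN S hS1 hS2 hS3
  · rintro b ⟨hσb, hvb⟩
    exact ⟨by rw [map_mul, hσθ, hσb], by rw [map_mul, hθ, one_mul]; exact hvb⟩
  · rintro b - b' -
    rw [← mul_sub, map_mul, hθ, one_mul]
  · rintro b ⟨hσb, -⟩ b' ⟨hσb', hvb'⟩ hbb'
    refine normSign_eq_of_near hD (by rw [map_add, map_one, hσb']) (by rw [map_add, map_one, hσb]) (Valued.v.map_one_add_of_lt (hball1 b' hvb')) hN ?_
    rw [show 1 + b' - (1 + b) = b' - b by ring, Valuation.map_sub_swap]; exact hbb'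

/-- **(s2, quadratic letter) `Σ_{b ∈ S} ω(1 + θ·b + θ₂·b²) = 0`** for a fixed unit `θ` and a fixed integral `θ₂` (the reparametrisation `b ↦ θb + θ₂b² = b(θ + θ₂b)` is a class isometry
of the ball since `θ + θ₂(b + b′)` is a unit; §1 invariance + the first head). [cite: Serre1979, Ch. XV §2] -/
theorem sum_normSign_quad_repr_ball_eq_zero [CompleteSpace K] [Finite 𝓀[K]] (hD : IsRamifiedQuadraticDatum σ ϖ d t) (h2v : Valued.v (2 : K) < 1)
    {θ θ₂ : K} (hσθ : σ θ = θ) (hθ : Valued.v θ = 1) (hσθ₂ : σ θ₂ = θ₂) (hθ₂ : Valued.v θ₂ ≤ 1) {k : ℕ} (hk : 1 ≤ k) (hkd : k + 1 ≤ d) {N : ℕ} (hN : 2 * d - 1 ≤ N)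
    (S : Finset K) (hS1 : ∀ b ∈ S, σ b = b ∧ Valued.v b ≤ Valued.v ϖ ^ (2 * k))
    (hS2 : ∀ b : K, σ b = b → Valued.v b ≤ Valued.v ϖ ^ (2 * k) → ∃ s ∈ S, Valued.v (b - s) ≤ Valued.v ϖ ^ N)
    (hS3 : ∀ s ∈ S, ∀ s' ∈ S, Valued.v (s - s') ≤ Valued.v ϖ ^ N → s = s') :
    ∑ b ∈ S, normSign σ (1 + θ * b + θ₂ * b ^ 2) = 0 := by
  obtain ⟨-, -, hϖ, -, -, -, -⟩ := id hD
  have hϖ1 : Valued.v ϖ < 1 := by rw [hϖ, ← exp_zero]; exact exp_lt_exp.2 (by norm_num)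
  have hball1 : ∀ b : K, Valued.v b ≤ Valued.v ϖ ^ (2 * k) → Valued.v b < 1 := fun b hb =>
    lt_of_le_of_lt hb (pow_lt_one₀ zero_le hϖ1 (by omega))
  -- the unit `θ + θ₂(b + b′)`
  have hunit : ∀ b b' : K, Valued.v b ≤ Valued.v ϖ ^ (2 * k) → Valued.v b' ≤ Valued.v ϖ ^ (2 * k) → Valued.v (θ + θ₂ * (b + b')) = 1 := by
    intro b b' hb hb'
    rw [Valuation.map_add_eq_of_lt_left]
    · exact hθ
    · rw [hθ, map_mul]
      refine mul_lt_one_of_nonneg_of_lt_one_right hθ₂ zero_le ?_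
      exact lt_of_le_of_lt ((Valuation.map_add _ _ _).trans (max_le hb hb')) (pow_lt_one₀ zero_le hϖ1 (by omega))
  have h := sum_comp_eq_sum_of_classIsometry (A := {b : K | σ b = b ∧ Valued.v b ≤ Valued.v ϖ ^ (2 * k)}) S hS1
    (fun b hb => hS2 b hb.1 hb.2) hS3 (fun b => θ * b + θ₂ * b ^ 2) ?_ ?_ (fun b => normSign σ (1 + b)) ?_
  · have h' : ∑ b ∈ S, normSign σ (1 + θ * b + θ₂ * b ^ 2) = ∑ b ∈ S, normSign σ (1 + (θ * b + θ₂ * b ^ 2)) :=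
      Finset.sum_congr rfl fun b _ => by rw [add_assoc]
    have h'' : ∑ b ∈ S, normSign σ (1 + (θ * b + θ₂ * b ^ 2)) = ∑ b ∈ S, normSign σ (1 + b) := h
    rw [h', h'']
    exact sum_normSign_one_add_repr_ball_eq_zero hD h2v hk hkd hN S hS1 hS2 hS3
  · rintro b ⟨hσb, hvb⟩
    refine ⟨by rw [map_add, map_mul, map_mul, map_pow, hσθ, hσθ₂, hσb], ?_⟩
    rw [show θ * b + θ₂ * b ^ 2 = b * (θ + θ₂ * b) by ring, map_mul]
    refine mul_le_of_le_of_le_one hvb ((Valuation.map_add _ _ _).trans (max_le hθ.le ?_))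
    rw [map_mul]; exact mul_le_one' hθ₂ (hvb.trans (pow_le_one₀ zero_le hϖ1.le))
  · rintro b ⟨-, hvb⟩ b' ⟨-, hvb'⟩
    rw [show θ * b + θ₂ * b ^ 2 - (θ * b' + θ₂ * b' ^ 2) = (b - b') * (θ + θ₂ * (b + b')) by ring, map_mul, hunit b b' hvb hvb', mul_one]
  · rintro b ⟨hσb, -⟩ b' ⟨hσb', hvb'⟩ hbb'
    refine normSign_eq_of_near hD (by rw [map_add, map_one, hσb']) (by rw [map_add, map_one, hσb]) (Valued.v.map_one_add_of_lt (hball1 b' hvb')) hN ?_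
    rw [show 1 + b' - (1 + b) = b' - b by ring, Valuation.map_sub_swap]; exact hbb'

end Summit.HodgeConjecture.HodgeConjecture.Cruxes.H413.F0P3cDyRamGlueClassCharSums

end
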